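import Mathlib
import Summits.NavierStokesRegularity.NavierStokesRegularity.Theorems.SubOnsagerCeilingDyadicWeightedChain
import Summits.NavierStokesRegularity.NavierStokesRegularity.Theorems.SubcriticalEnvelopeForwardSourceTailEnvelopeKPTwoCycle
import HarnessLib

/-!
# The ASYMMETRIC Katz–Pavlović re-entry pair `kpTwoCycleTable c₀ c₁` (`c₀ ≠ c₁`): a ν-uniform shell barrier inside the
# weight window of the per-bond region (helper file for crux stmt-NavierStokesRegularity-27057
# `SubOnsagerCeiling.ForwardTailCeilingKP`, `--supports`; first RECURRENT corner beyond the LEAD skeleton's list)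

The re-entry pair `kpTwoCycleTable c₀ c₁` (feeds `x_{0,k}² → x_{1,k+1}'` with weight `c₀`, `x_{1,k}² → x_{0,k+1}'` with weight
`c₁`) is covered by RUNG 8 of `Cruxes/ForwardTailCeilingKP/Lines/kp_shell_barrier.lean` ONLY for `c₀ = c₁` (its strands are then
scaled dyadic chains).  For `c₀ ≠ c₁` the strands are chains with ALTERNATING bond weights (LEAD SE's `quadTerm_kpTwoCycle_phase`),
«for which no barrier is in the tree» (census v9 §G).  `DyadicRange.chain_shellBarrier_weighted` (p816233, on the per-bond region
lemma p816115) now provides one inside the window `p²·c₀²·b^θ ≤ c₁²·b^{5/2}`, `p²·c₁²·b^θ ≤ c₀²·b^{5/2}`, `p = b^{5/2}/(b^θ)³ ≥ 42/25`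
(`b = 1 + ε₀`):

* `kpTwoCycleAsym_shellBarrier` — along every honest non-negative `ν`-viscous solution of `kpTwoCycleTable c₀ c₁` from any one-shell
  datum, `(1+ε₀)^{2θk}·½X_{i,k}(t)² ≤ 100·(max(c₀,c₁)/min(c₀,c₁))²·Σ_j ½(X₀)_j²` for every mode, shell and time — uniformly in `ν`;
  the strands `Z_k = X_{phase,k}` are weighted chains with `w_k ∈ {c₀, c₁}` by parity and companion `σ_k = w_k/w_0`, the idle
  components `2, 3` only decay.
  Example: `ε₀ = 1`, `θ = 0.58`: `p = 2^{0.76} ≈ 1.69 ≥ 1.68` and the window is `c₁/c₀ ∈ [2^{-0.21}, 2^{0.21}] ≈ [0.87, 1.15]`.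

HONEST FRAMING: MODEL lattice ODEs (route SubOnsagerCeiling, rung TL-M2Break); a corner of the registered stubs
`stub_primaryGradedLargeRatio` (asymmetric re-entry pairs with mild asymmetry at large ratios), not the stubs; nothing here
bears on Navier–Stokes regularity and no stub, crux or summit is proved. [cite: BarbatoMorandinRomito2011, §2 Lemma 2.1, §3.2]
[cite: Tao2016AveragedNS, §4 (4.5), (4.13)]
-/

noncomputable section

-- the sub-problem namespace `NavierStokesRegularity.NavierStokesRegularity` is the tree's layout (D-0017)
set_option linter.dupNamespace false

namespace Summit.NavierStokesRegularity.NavierStokesRegularity.Theorems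

open Set
open Literature.Analysis.FluidPDE.TaoCascade
open Summit.NavierStokesRegularity.NavierStokesRegularity.Theorems.SubOnsagerCeiling
open Summit.NavierStokesRegularity.NavierStokesRegularity.Theses

/-- **ν-UNIFORM SHELL BARRIER FOR THE ASYMMETRIC RE-ENTRY PAIR inside the weight window** (see the module docstring):
for `c₀, c₁ > 0`, `ε₀ > 0`, `θ < 10`, `p = (1+ε₀)^{5/2}/((1+ε₀)^θ)³ ≥ 42/25` and the two window inequalities, along every honest
non-negative `ν`-viscous solution of `kpTwoCycleTable c₀ c₁` on `[0,s]` from a one-shell datum `X₀`,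
`(1+ε₀)^{2θk}·½X_{i,k}(t)² ≤ 100·(max(c₀,c₁)/min(c₀,c₁))²·Σ_j ½(X₀)_j²`. MODEL lattice statement.
[cite: BarbatoMorandinRomito2011, §2 Lemma 2.1 and §3.2] -/
theorem kpTwoCycleAsym_shellBarrier {c₀ c₁ ε₀ θ : ℝ} (hc₀ : 0 < c₀) (hc₁ : 0 < c₁) (hε : 0 < ε₀) (hε1 : ε₀ ≤ 1)
    (hθ10 : θ < 10) (hp : 42 / 25 ≤ (1 + ε₀) ^ ((5 : ℝ) / 2) / ((1 + ε₀) ^ θ) ^ 3)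
    (hwin₀ : ((1 + ε₀) ^ ((5 : ℝ) / 2) / ((1 + ε₀) ^ θ) ^ 3) ^ 2 * c₀ ^ 2 * (1 + ε₀) ^ θ ≤
      c₁ ^ 2 * (1 + ε₀) ^ ((5 : ℝ) / 2))
    (hwin₁ : ((1 + ε₀) ^ ((5 : ℝ) / 2) / ((1 + ε₀) ^ θ) ^ 3) ^ 2 * c₁ ^ 2 * (1 + ε₀) ^ θ ≤
      c₀ ^ 2 * (1 + ε₀) ^ ((5 : ℝ) / 2)) :
    ∀ ν : ℝ, 0 < ν → ∀ (X₀ : Fin 4 → ℝ) (s : ℝ), 0 < s → ∀ X : Fin 4 → ℤ → ℝ → ℝ,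
      (∀ (i : Fin 4) (k : ℤ), X i k 0 = if k = 0 then X₀ i else 0) →
      (∀ (i : Fin 4) (k : ℤ), k < 0 → ∀ t : ℝ, X i k t = 0) →
      (∃ M : ℝ, ∀ (t : ℝ) (i : Fin 4) (k : ℤ), (1 + (1 + ε₀) ^ ((10 : ℝ) * k)) * |X i k t| ≤ M) →
      (∀ (i : Fin 4) (k : ℤ), Continuous (X i k)) →
      (∀ (i : Fin 4) (k : ℤ), ∀ t ∈ Set.Icc (0 : ℝ) s, HasDerivWithinAt (X i k)
        (quadTerm ε₀ (kpTwoCycleTable c₀ c₁) X i k t - ν * (1 + ε₀) ^ ((2 : ℝ) * k) * X i k t)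
        (Set.Icc (0 : ℝ) s) t) →
      (∀ t ∈ Set.Icc (0 : ℝ) s, ∀ (i : Fin 4) (k : ℤ), 1 ≤ k → 0 ≤ X i k t) →
      ∀ t ∈ Set.Icc (0 : ℝ) s, ∀ (i : Fin 4) (k : ℕ),
        (1 + ε₀) ^ (2 * θ * (k : ℝ)) * ((1 / 2 : ℝ) * X i (k : ℤ) t ^ 2) ≤
          100 * (max c₀ c₁ / min c₀ c₁) ^ 2 * (∑ j : Fin 4, (1 / 2 : ℝ) * X₀ j ^ 2) := by
  intro ν hν X₀ s hs X hinit hlow hbd hcont hder hnn t ht i k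
  set b : ℝ := 1 + ε₀ with hb
  have hb1 : 1 ≤ b := by rw [hb]; linarith
  have hb2 : b ≤ 2 := by rw [hb]; linarith
  have hb0 : 0 < b := by linarith
  set E₀ : ℝ := ∑ j : Fin 4, (1 / 2 : ℝ) * X₀ j ^ 2 with hE₀
  have hE₀i : ∀ j : Fin 4, (1 / 2 : ℝ) * X₀ j ^ 2 ≤ E₀ := fun j =>
    Finset.single_le_sum (f := fun j => (1 / 2 : ℝ) * X₀ j ^ 2) (fun j _ => by positivity) (Finset.mem_univ j)
  have hE₀0 : 0 ≤ E₀ := Finset.sum_nonneg fun j _ => by positivity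
  -- the constant `D = 100 (max/min)²`
  set m₀ : ℝ := min c₀ c₁ with hm₀
  set M₀ : ℝ := max c₀ c₁ with hM₀
  have hm₀0 : 0 < m₀ := lt_min hc₀ hc₁
  have hM₀0 : 0 < M₀ := lt_max_of_lt_left hc₀
  have hmM : m₀ ≤ M₀ := min_le_max
  set D : ℝ := 100 * (M₀ / m₀) ^ 2 with hD
  have hD100 : 100 ≤ D := by
    have : 1 ≤ M₀ / m₀ := by rw [le_div_iff₀ hm₀0]; linarith
    have : 1 ≤ (M₀ / m₀) ^ 2 := one_le_pow₀ this
    rw [hD]; nlinarith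
  have hD0 : 0 ≤ D := by linarith
  -- idle components `2, 3`: damped from their datum
  have hidle : ∀ i : Fin 4, (i = 2 ∨ i = 3) →
      b ^ (2 * θ * (k : ℝ)) * ((1 / 2 : ℝ) * X i (k : ℤ) t ^ 2) ≤ D * E₀ := by
    intro i hi
    have hsq := sq_le_sq_init_of_damped (y := X i (k : ℤ))
      (q := fun u => quadTerm ε₀ (kpTwoCycleTable c₀ c₁) X i (k : ℤ) u)
      (c := ν * (1 + ε₀) ^ ((2 : ℝ) * ((k : ℕ) : ℤ))) (s := s)
      (mul_nonneg hν.le (Real.rpow_nonneg hb0.le _)) (hcont i k)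
      (fun u _ => quadTerm_kpTwoCycle_idle ε₀ c₀ c₁ X hi (k : ℤ) u)
      (fun u hu => hder i k u hu) t ht
    have hw : b ^ (2 * θ * (k : ℝ)) * ((1 / 2 : ℝ) * X i (k : ℤ) t ^ 2) ≤
        b ^ (2 * θ * (k : ℝ)) * ((1 / 2 : ℝ) * X i (k : ℤ) 0 ^ 2) :=
      mul_le_mul_of_nonneg_left (by nlinarith [hsq]) (Real.rpow_nonneg hb0.le _)
    refine hw.trans ?_
    rw [hinit]
    by_cases hk : ((k : ℕ) : ℤ) = 0
    · have hk0 : k = 0 := by exact_mod_cast hk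
      subst hk0
      simp only [hk, if_true, Nat.cast_zero, mul_zero, Real.rpow_zero, one_mul]
      exact (hE₀i i).trans (by nlinarith [hE₀0])
    · simp only [hk, if_false]
      have : (0 : ℝ) ^ 2 = 0 := by norm_num
      rw [this, mul_zero, mul_zero]
      positivity
  -- the strands: weighted chains with alternating weights
  have hstrand : ∀ r : ℤ, b ^ (2 * θ * (k : ℝ)) * ((1 / 2 : ℝ) * X (cyclePhase r k) (k : ℤ) t ^ 2) ≤ D * E₀ := by
    intro r
    -- weights by parity of the position, companion `σ_k = w_k / w_0`
    set w : ℕ → ℝ := fun n => if (((n : ℤ) + r) % 2 = 0) then c₀ else c₁ with hw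
    have hwpos : ∀ n, 0 < w n := fun n => by simp only [hw]; split_ifs <;> assumption
    have hwlo : ∀ n, m₀ ≤ w n := fun n => by
      simp only [hw]; split_ifs
      · exact min_le_left _ _
      · exact min_le_right _ _
    have hwhi : ∀ n, w n ≤ M₀ := fun n => by
      simp only [hw]; split_ifs
      · exact le_max_left _ _
      · exact le_max_right _ _
    have hw2 : ∀ n, w (n + 2) = w n := fun n => by
      simp only [hw]
      have : (((n + 2 : ℕ) : ℤ) + r) % 2 = (((n : ℕ) : ℤ) + r) % 2 := by push_cast; omega
      rw [this]
    -- the window, bond by bond: `p² w_n² b^θ ≤ w_{n+1}² b^{5/2}`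
    have hwin : ∀ n, ((1 + ε₀) ^ ((5 : ℝ) / 2) / ((1 + ε₀) ^ θ) ^ 3) ^ 2 * w n ^ 2 * (1 + ε₀) ^ θ ≤
        w (n + 1) ^ 2 * (1 + ε₀) ^ ((5 : ℝ) / 2) := by
      intro n
      have hflip : ((((n + 1 : ℕ) : ℤ) + r) % 2 = 0) ↔ ¬ ((((n : ℕ) : ℤ) + r) % 2 = 0) := by
        push_cast; omega
      by_cases h0 : (((n : ℕ) : ℤ) + r) % 2 = 0
      · have h1 : ¬ ((((n + 1 : ℕ) : ℤ) + r) % 2 = 0) := fun h => (hflip.1 h) h0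
        simp only [hw, if_pos h0, if_neg h1]
        exact hwin₀
      · have h1 : (((n + 1 : ℕ) : ℤ) + r) % 2 = 0 := hflip.2 h0
        simp only [hw, if_neg h0, if_pos h1]
        exact hwin₁
    set σc : ℕ → ℝ := fun n => w n / w 0 with hσcdef
    have hσcpos : ∀ n, 0 < σc n := fun n => div_pos (hwpos n) (hwpos 0)
    have hσc0 : σc 0 = 1 := div_self (hwpos 0).ne'
    set σmin : ℝ := m₀ / M₀ with hσmin
    set σmax : ℝ := M₀ / m₀ with hσmax
    have hσmin0 : 0 < σmin := div_pos hm₀0 hM₀0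
    have hσlo : ∀ n, σmin ≤ σc n := fun n => by
      simp only [hσcdef, hσmin]
      exact div_le_div₀ (le_trans hm₀0.le (hwlo n)) (hwlo n) (hwpos 0) (hwhi 0)
    have hσhi : ∀ n, σc n ≤ σmax := fun n => by
      simp only [hσcdef, hσmax]
      exact div_le_div₀ hM₀0.le (hwhi n) hm₀0 (hwlo 0)
    have hbal : ∀ n, w (n + 1) * σc n ^ 2 = w n * σc (n + 1) * σc (n + 2) := fun n => by
      simp only [hσcdef]
      rw [hw2 n]
      field_simp
    have hwinσ : ∀ n, ((1 + ε₀) ^ ((5 : ℝ) / 2) / ((1 + ε₀) ^ θ) ^ 3) ^ 2 * (w n * σc (n + 2)) * (1 + ε₀) ^ θ ≤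
        (w (n + 1) * σc (n + 1)) * (1 + ε₀) ^ ((5 : ℝ) / 2) := by
      intro n
      simp only [hσcdef]
      rw [hw2 n]
      have hw0 : 0 < w 0 := hwpos 0
      have key := div_le_div_of_nonneg_right (hwin n) hw0.le
      have e1 : ((1 + ε₀) ^ ((5 : ℝ) / 2) / ((1 + ε₀) ^ θ) ^ 3) ^ 2 * w n ^ 2 * (1 + ε₀) ^ θ / w 0 =
          ((1 + ε₀) ^ ((5 : ℝ) / 2) / ((1 + ε₀) ^ θ) ^ 3) ^ 2 * (w n * (w n / w 0)) * (1 + ε₀) ^ θ := by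
        field_simp
      have e2 : w (n + 1) ^ 2 * (1 + ε₀) ^ ((5 : ℝ) / 2) / w 0 =
          w (n + 1) * (w (n + 1) / w 0) * (1 + ε₀) ^ ((5 : ℝ) / 2) := by
        field_simp
      rw [e1, e2] at key
      exact key
    -- the strand as a scalar chain
    set Z : ℤ → ℝ → ℝ := fun m τ => X (cyclePhase r m) m τ with hZ
    have hdat' : ∀ m : ℤ, Z m 0 = if m = 0 then X₀ (cyclePhase r 0) else 0 := by
      intro m
      simp only [hZ]
      rw [hinit]
      by_cases hm : m = 0
      · subst hm; simp
      · simp [hm]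
    have hvan' : ∀ τ, Z (-1) τ = 0 := fun τ => hlow _ (-1) (by norm_num) τ
    have hbdd' : ∃ M : ℝ, ∀ (τ : ℝ) (m : ℕ), (1 + b ^ ((10 : ℝ) * m)) * |Z m τ| ≤ M := by
      obtain ⟨M, hM⟩ := hbd
      exact ⟨M, fun τ m => by simpa [hZ] using hM τ (cyclePhase r m) m⟩
    have hcont' : ∀ m : ℕ, ContinuousOn (Z m) (Icc 0 s) := fun m => (hcont (cyclePhase r m) m).continuousOn
    have hnn' : ∀ τ ∈ Icc 0 s, ∀ m : ℕ, 1 ≤ m → 0 ≤ Z m τ := fun τ hτ m hm =>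
      hnn τ hτ (cyclePhase r m) m (by exact_mod_cast hm)
    have hode' : ∀ m : ℕ, ∀ τ ∈ Icc 0 s, HasDerivWithinAt (Z m)
        (w (m - 1) * b ^ ((5 : ℝ) * ((m : ℝ) - 1) / 2) * Z ((m : ℤ) - 1) τ ^ 2 -
            w m * b ^ ((5 : ℝ) * (m : ℝ) / 2) * (Z m τ * Z ((m : ℤ) + 1) τ) -
          ν * b ^ ((2 : ℝ) * (m : ℝ)) * Z m τ) (Icc 0 s) τ := by
      intro m τ hτ
      have h := hder (cyclePhase r m) m τ hτ
      rw [quadTerm_kpTwoCycle_phase, cycleStrand_zero, cycleStrand_zero, cycleStrand_zero] at h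
      have hfun : Z m = X (cyclePhase r m) m := rfl
      rw [hfun]
      refine h.congr_deriv ?_
      simp only [hZ]
      push_cast
      rcases Nat.eq_zero_or_pos m with rfl | hm
      · -- datum shell: both feed terms vanish
        simp only [Nat.cast_zero, zero_sub, hlow _ (-1) (by norm_num) τ]
        simp [hw]
      · -- `m ≥ 1`: the feed weight is the weight of the position `m - 1`
        have hwm : (if (((m : ℕ) : ℤ) + r) % 2 = 0 then c₁ else c₀) = w (m - 1) := by
          simp only [hw]
          have hflip : ((((m - 1 : ℕ) : ℤ) + r) % 2 = 0) ↔ ¬ ((((m : ℕ) : ℤ) + r) % 2 = 0) := by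
            push_cast [Nat.cast_sub hm]; omega
          by_cases h0 : (((m : ℕ) : ℤ) + r) % 2 = 0
          · rw [if_pos h0, if_neg (fun h => (hflip.1 h) h0)]
          · rw [if_neg h0, if_pos (hflip.2 h0)]
        have hwm' : (if (((m : ℕ) : ℤ) + r) % 2 = 0 then c₀ else c₁) = w m := by simp only [hw]
        rw [hwm, hwm']
        ring
    have key := DyadicRange.chain_shellBarrier_weighted hb1 hb2 hθ10 hp hwpos hσcpos hσc0 hσmin0 hσlo hσhi
      hbal hwinσ hν hs hdat' hvan' hbdd' hcont' hode' hnn' t ht k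
    -- `(1+ε₀)^{2θk} = (b^θ)^{2k}` and `100/σmin² = D`
    have hpow : b ^ (2 * θ * (k : ℝ)) = (b ^ θ) ^ (2 * k) := by
      rw [← Real.rpow_mul_natCast hb0.le]
      congr 1; push_cast; ring
    have hDσ : 100 / σmin ^ 2 = D := by
      rw [hD, hσmin, hσmax]
      field_simp
    rw [hpow]
    have hZk : Z (k : ℤ) t = X (cyclePhase r k) (k : ℤ) t := rfl
    rw [hDσ, hZk] at key
    calc (b ^ θ) ^ (2 * k) * ((1 / 2 : ℝ) * X (cyclePhase r k) (k : ℤ) t ^ 2)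
        = (1 / 2 : ℝ) * ((b ^ θ) ^ (2 * k) * X (cyclePhase r k) (k : ℤ) t ^ 2) := by ring
      _ ≤ (1 / 2 : ℝ) * (D * X₀ (cyclePhase r 0) ^ 2) := by linarith
      _ = D * ((1 / 2 : ℝ) * X₀ (cyclePhase r 0) ^ 2) := by ring
      _ ≤ D * E₀ := mul_le_mul_of_nonneg_left (hE₀i _) hD0
  fin_cases i
  · have hph : cyclePhase ((k : ℤ) % 2) (k : ℤ) = 0 := by
      have heq : ((k : ℤ) + (k : ℤ) % 2) % 2 = 0 := by omega
      simp only [cyclePhase, if_pos heq]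
    have := hstrand ((k : ℤ) % 2)
    rw [hph] at this
    simpa using this
  · have hph : cyclePhase (((k : ℤ) + 1) % 2) (k : ℤ) = 1 := by
      have hne : ¬ (((k : ℤ) + ((k : ℤ) + 1) % 2) % 2 = 0) := by omega
      simp only [cyclePhase, if_neg hne]
    have := hstrand (((k : ℤ) + 1) % 2)
    rw [hph] at this
    simpa using this
  · simpa using hidle 2 (Or.inl rfl)
  · simpa using hidle 3 (Or.inr rfl)

/-- **The asymmetric re-entry pair in the skeletons' binder shape**: `ShellBarrierAt R ε₀ (kpTwoCycleTable c₀ c₁)` for every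
spread `R`, inside the window and with `θ > 1/2` (the table-class and orthant binders are not needed). [this file] -/
theorem kpTwoCycleAsym_shellBarrierAt {c₀ c₁ ε₀ θ : ℝ} (hc₀ : 0 < c₀) (hc₁ : 0 < c₁) (hε : 0 < ε₀) (hε1 : ε₀ ≤ 1)
    (hθ : 1 / 2 < θ) (hθ10 : θ < 10) (hp : 42 / 25 ≤ (1 + ε₀) ^ ((5 : ℝ) / 2) / ((1 + ε₀) ^ θ) ^ 3)
    (hwin₀ : ((1 + ε₀) ^ ((5 : ℝ) / 2) / ((1 + ε₀) ^ θ) ^ 3) ^ 2 * c₀ ^ 2 * (1 + ε₀) ^ θ ≤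
      c₁ ^ 2 * (1 + ε₀) ^ ((5 : ℝ) / 2))
    (hwin₁ : ((1 + ε₀) ^ ((5 : ℝ) / 2) / ((1 + ε₀) ^ θ) ^ 3) ^ 2 * c₁ ^ 2 * (1 + ε₀) ^ θ ≤
      c₀ ^ 2 * (1 + ε₀) ^ ((5 : ℝ) / 2)) (R : ℝ) :
    ShellBarrierAt R ε₀ (kpTwoCycleTable c₀ c₁) := by
  intro _hT _hO
  exact ⟨θ, hθ, 100 * (max c₀ c₁ / min c₀ c₁) ^ 2, by positivity,
    kpTwoCycleAsym_shellBarrier hc₀ hc₁ hε hε1 hθ10 hp hwin₀ hwin₁⟩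

/-- **Tail ceiling for the asymmetric re-entry pair inside the window**: `CeilingAt R ε₀ (kpTwoCycleTable c₀ c₁)`, by the
shell-barrier ⇒ ceiling glue; composes with the LEAD skeleton's `fwdCeilingKPAt_of_ceilingAt` into `FwdCeilingKPAt`
(a new `by_cases` corner next to RUNG 8). [this file] -/
theorem kpTwoCycleAsym_ceilingAt {c₀ c₁ ε₀ θ : ℝ} (hc₀ : 0 < c₀) (hc₁ : 0 < c₁) (hε : 0 < ε₀) (hε1 : ε₀ ≤ 1)
    (hθ : 1 / 2 < θ) (hθ10 : θ < 10) (hp : 42 / 25 ≤ (1 + ε₀) ^ ((5 : ℝ) / 2) / ((1 + ε₀) ^ θ) ^ 3)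
    (hwin₀ : ((1 + ε₀) ^ ((5 : ℝ) / 2) / ((1 + ε₀) ^ θ) ^ 3) ^ 2 * c₀ ^ 2 * (1 + ε₀) ^ θ ≤
      c₁ ^ 2 * (1 + ε₀) ^ ((5 : ℝ) / 2))
    (hwin₁ : ((1 + ε₀) ^ ((5 : ℝ) / 2) / ((1 + ε₀) ^ θ) ^ 3) ^ 2 * c₁ ^ 2 * (1 + ε₀) ^ θ ≤
      c₀ ^ 2 * (1 + ε₀) ^ ((5 : ℝ) / 2)) (R : ℝ) :
    CeilingAt R ε₀ (kpTwoCycleTable c₀ c₁) :=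
  subOnsagerCeiling_ceilingAt_of_shellBarrierAt hε
    (kpTwoCycleAsym_shellBarrierAt hc₀ hc₁ hε hε1 hθ hθ10 hp hwin₀ hwin₁ R)

/-! ## Non-vacuity of the window: `c₀ = 11/10`, `c₁ = 1` at `ε₀ = 1`, `θ = 29/50` -/

/-- `42/25 ≤ 2^{19/25}` (since `(42/25)^{25} ≤ 2^{19}`). [folklore] -/
theorem asym_rpow_p_ge : (42 / 25 : ℝ) ≤ (2 : ℝ) ^ ((19 : ℝ) / 25) := by
  have h0 : (0 : ℝ) ≤ (2 : ℝ) ^ ((19 : ℝ) / 25) := by positivity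
  have h2 : ((2 : ℝ) ^ ((19 : ℝ) / 25)) ^ (25 : ℕ) = (2 : ℝ) ^ (19 : ℕ) := by
    rw [← Real.rpow_natCast, ← Real.rpow_mul (by norm_num)]; norm_num
  rcases le_or_gt (42 / 25 : ℝ) ((2 : ℝ) ^ ((19 : ℝ) / 25)) with h | h
  · exact h
  · exfalso
    have h3 : ((2 : ℝ) ^ ((19 : ℝ) / 25)) ^ (25 : ℕ) < (42 / 25 : ℝ) ^ (25 : ℕ) :=
      pow_lt_pow_left₀ h h0 (by norm_num)
    rw [h2] at h3
    norm_num at h3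

/-- `121/100 ≤ 2^{2/5}` (since `(121/100)^5 ≤ 4`). [folklore] -/
theorem asym_rpow_window_ge : (121 / 100 : ℝ) ≤ (2 : ℝ) ^ ((2 : ℝ) / 5) := by
  have h0 : (0 : ℝ) ≤ (2 : ℝ) ^ ((2 : ℝ) / 5) := by positivity
  have h2 : ((2 : ℝ) ^ ((2 : ℝ) / 5)) ^ (5 : ℕ) = (2 : ℝ) ^ (2 : ℕ) := by
    rw [← Real.rpow_natCast, ← Real.rpow_mul (by norm_num)]; norm_num
  rcases le_or_gt (121 / 100 : ℝ) ((2 : ℝ) ^ ((2 : ℝ) / 5)) with h | h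
  · exact h
  · exfalso
    have h3 : ((2 : ℝ) ^ ((2 : ℝ) / 5)) ^ (5 : ℕ) < (121 / 100 : ℝ) ^ (5 : ℕ) :=
      pow_lt_pow_left₀ h h0 (by norm_num)
    rw [h2] at h3
    norm_num at h3

/-- The rescaling constants at `b = 2`, `θ = 29/50`: `p = 2^{19/25}`, `p²·b^θ = 2^{21/10}`, `b^{5/2} = 2^{21/10}·2^{2/5}`.
[folklore] -/
theorem asym_rpow_consts :
    (2 : ℝ) ^ ((5 : ℝ) / 2) / ((2 : ℝ) ^ ((29 : ℝ) / 50)) ^ 3 = (2 : ℝ) ^ ((19 : ℝ) / 25) ∧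
    ((2 : ℝ) ^ ((19 : ℝ) / 25)) ^ 2 * (2 : ℝ) ^ ((29 : ℝ) / 50) = (2 : ℝ) ^ ((21 : ℝ) / 10) ∧
    (2 : ℝ) ^ ((5 : ℝ) / 2) = (2 : ℝ) ^ ((21 : ℝ) / 10) * (2 : ℝ) ^ ((2 : ℝ) / 5) := by
  refine ⟨?_, ?_, ?_⟩
  · rw [← Real.rpow_natCast, ← Real.rpow_mul (by norm_num), ← Real.rpow_sub (by norm_num)]
    norm_num
  · rw [← Real.rpow_natCast, ← Real.rpow_mul (by norm_num), ← Real.rpow_add (by norm_num)]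
    norm_num
  · rw [← Real.rpow_add (by norm_num)]; norm_num

/-- **NON-VACUITY OF THE WINDOW: the asymmetric pair `kpTwoCycleTable (11/10) 1` at scale ratio `2`** (`ε₀ = 1`, `θ = 29/50`:
`p = 2^{19/25} ≥ 42/25`, window `1.21 ≤ 2^{2/5}`) satisfies the tail ceiling `CeilingAt R 1`, for every spread `R` — a 10 %
weight asymmetry, outside RUNG 8. MODEL lattice statement; no stub, crux or summit is proved. [cite: BarbatoMorandinRomito2011, §3.2] -/
theorem kpTwoCycleAsym_ceilingAt_example (R : ℝ) : CeilingAt R 1 (kpTwoCycleTable (11 / 10) 1) := by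
  obtain ⟨e1, e2, e3⟩ := asym_rpow_consts
  have hb : (1 : ℝ) + 1 = 2 := by norm_num
  have hP : 0 < (2 : ℝ) ^ ((21 : ℝ) / 10) := by positivity
  have hQ : (1 : ℝ) ≤ (2 : ℝ) ^ ((2 : ℝ) / 5) := Real.one_le_rpow (by norm_num) (by norm_num)
  refine kpTwoCycleAsym_ceilingAt (c₀ := 11 / 10) (c₁ := 1) (ε₀ := 1) (θ := 29 / 50) (by norm_num) one_pos
    one_pos le_rfl (by norm_num) (by norm_num) ?_ ?_ ?_ R
  · rw [hb, e1]; exact asym_rpow_p_ge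
  · rw [hb, e1]
    have e : ((2 : ℝ) ^ ((19 : ℝ) / 25)) ^ 2 * (11 / 10 : ℝ) ^ 2 * (2 : ℝ) ^ ((29 : ℝ) / 50) =
        (121 / 100 : ℝ) * (2 : ℝ) ^ ((21 : ℝ) / 10) := by rw [← e2]; ring
    rw [e, one_pow, one_mul, e3]
    nlinarith [asym_rpow_window_ge]
  · rw [hb, e1]
    have e : ((2 : ℝ) ^ ((19 : ℝ) / 25)) ^ 2 * (1 : ℝ) ^ 2 * (2 : ℝ) ^ ((29 : ℝ) / 50) =
        (2 : ℝ) ^ ((21 : ℝ) / 10) := by rw [← e2]; ring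
    rw [e, e3]
    nlinarith [asym_rpow_window_ge]

end Summit.NavierStokesRegularity.NavierStokesRegularity.Theorems

end
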